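import Mathlib
import HarnessLib
import Summits.KontsevichZagierPeriods.KontsevichZagierPeriods.Theses.LinRedNormalForm
import Summits.KontsevichZagierPeriods.KontsevichZagierPeriods.Theorems.LinRedNormalFormDihedralNormalFormVertexSplitting
import Literature.NumberTheory.Transcendental.KZCalculus

/-!
# `DihedralNormalForm`, line `torus-descent-sum-shadow`, stub `stub_dilationNL` — the dilation chart (Aux 2)

Support file for the stub `stub_dilationNL` (the Euler / dilation Newton–Leibniz move on the open
ordered simplex `Δᵏ⁺¹ = {1 > t₀ > ⋯ > t_k > 0}`) of the crux `DihedralNormalForm`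
(stmt-KontsevichZagierPeriods-3912, route `LinRedNormalForm`).  The calculus of the **dilation
chart** of a slot `m`: `dch m t = (t₀, …, t_m, t_{m+1} H/t_m, …, t_k H/t_m)` with `H = t_{m-1}`
(`H = 1` when `m = 0`), which straightens the orbits of the dilation field `D = Σ_{j ≥ m} tⱼ ∂ⱼ`
(they become the `t_m`-axis) and keeps the face `t_m = t_{m-1}` pointwise fixed:

* `hiC`, `dch`, the inverse chart `dinv`, and their coordinate descriptions;
* the derivative `dchD` (LOWER TRIANGULAR: row `i > m` is supported on the columns `m - 1, m, i`)
  and its Jacobian determinant `(H/t_m)^{k-m}` (`Matrix.det_of_lowerTriangular`);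
* `ℚ`-semialgebraicity of both charts and injectivity.

References: M. Kontsevich, D. Zagier, *Periods* (2001), §1.2 (rule (2)).
-/

noncomputable section

open MeasureTheory Set

namespace Summit.KontsevichZagierPeriods.DihedralNormalForm.TorusDescent

open Literature.NumberTheory.Transcendental
open Literature.ModelTheory.ExponentialFields (IsSemialgebraic)
open Summit.KontsevichZagierPeriods.DihedralNormalForm.VertexSplitting

namespace Dilation

variable {k : ℕ}

/-! ### The upper neighbour of the slot -/

/-- The upper neighbour of the slot `m` read on simplex coordinates: `t_{m-1}`, or `1` if `m = 0`. -/
def hiC (m : Fin (k + 1)) (t : Fin (k + 1) → ℝ) : ℝ := hiEdge m (Fin.removeNth m t)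

/-- `hiC` of an inserted tuple is the `hiEdge` of the tuple. -/
@[simp] theorem hiC_insertNth (m : Fin (k + 1)) (u : ℝ) (y : Fin k → ℝ) :
    hiC m (Fin.insertNth m u y) = hiEdge m y := by
  simp [hiC]

/-- `hiC` as a coordinate (or the constant `1`). -/
theorem hiC_eq (m : Fin (k + 1)) (t : Fin (k + 1) → ℝ) :
    hiC m t = if h : 0 < (m : ℕ) then t ⟨(m : ℕ) - 1, by omega⟩ else 1 := by
  unfold hiC hiEdge
  split_ifs with h
  · rw [Fin.removeNth_apply, Fin.succAbove_of_castSucc_lt _ _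
      (by rw [Fin.lt_def, Fin.val_castSucc]; exact Nat.sub_lt h one_pos)]
    rfl
  · rfl

/-- The derivative of `hiC` (a coordinate projection or `0`). -/
def hiCD (m : Fin (k + 1)) : (Fin (k + 1) → ℝ) →L[ℝ] ℝ :=
  if h : 0 < (m : ℕ) then
    ContinuousLinearMap.proj (R := ℝ) (φ := fun _ : Fin (k + 1) => ℝ) ⟨(m : ℕ) - 1, by omega⟩
  else 0

/-- `hiC` is differentiable with derivative `hiCD`. -/
theorem hasFDerivAt_hiC (m : Fin (k + 1)) (t : Fin (k + 1) → ℝ) :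
    HasFDerivAt (hiC m) (hiCD m) t := by
  have hfun : hiC (k := k) m = fun t => if h : 0 < (m : ℕ) then t ⟨(m : ℕ) - 1, by omega⟩ else 1 :=
    funext (hiC_eq m)
  rw [hfun]
  unfold hiCD
  split_ifs with h
  · exact hasFDerivAt_apply _ t
  · exact hasFDerivAt_const _ _

/-- `hiCD` evaluated on a vector. -/
theorem hiCD_apply (m : Fin (k + 1)) (v : Fin (k + 1) → ℝ) :
    hiCD m v = if h : 0 < (m : ℕ) then v ⟨(m : ℕ) - 1, by omega⟩ else 0 := by
  unfold hiCD
  split_ifs <;> simp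

/-- `hiC` is `ℚ`-semialgebraic on every `ℚ`-semialgebraic set. -/
theorem isSemialgebraicFunOn_hiC {S : Set (Fin (k + 1) → ℝ)} (hS : IsSemialgebraic ℚ S)
    (m : Fin (k + 1)) : IsSemialgebraicFunOn ℚ S (hiC m) := by
  by_cases h : 0 < (m : ℕ)
  · have : hiC (k := k) m = fun t => t ⟨(m : ℕ) - 1, by omega⟩ :=
      funext fun t => by rw [hiC_eq, dif_pos h]
    rw [this]
    exact isSemialgebraicFunOn_apply hS _
  · have : hiC (k := k) m = fun _ => ((1 : ℚ) : ℝ) :=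
      funext fun t => by rw [hiC_eq, dif_neg h]; simp
    rw [this]
    exact isSemialgebraicFunOn_const_ratCast hS 1

/-! ### The chart and its inverse -/

/-- **The dilation chart** of the slot `m`: `tᵢ ↦ tᵢ` for `i ≤ m`, `tᵢ ↦ tᵢ · H / t_m` for `i > m`. -/
def dch (m : Fin (k + 1)) (t : Fin (k + 1) → ℝ) : Fin (k + 1) → ℝ :=
  fun i => if i ≤ m then t i else t i * hiC m t / t m

/-- **The inverse chart**: `tᵢ ↦ tᵢ` for `i ≤ m`, `tᵢ ↦ tᵢ · t_m / H` for `i > m`. -/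
def dinv (m : Fin (k + 1)) (t : Fin (k + 1) → ℝ) : Fin (k + 1) → ℝ :=
  fun i => if i ≤ m then t i else t i * t m / hiC m t

variable (m : Fin (k + 1))

/-- The chart keeps the coordinates up to the slot. -/
theorem dch_apply_of_le {t : Fin (k + 1) → ℝ} {i : Fin (k + 1)} (h : i ≤ m) :
    dch m t i = t i := if_pos h

/-- The chart rescales the coordinates after the slot by `H/t_m`. -/
theorem dch_apply_of_lt {t : Fin (k + 1) → ℝ} {i : Fin (k + 1)} (h : m < i) :
    dch m t i = t i * hiC m t / t m := if_neg (not_le.2 h)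

/-- The inverse chart keeps the coordinates up to the slot. -/
theorem dinv_apply_of_le {t : Fin (k + 1) → ℝ} {i : Fin (k + 1)} (h : i ≤ m) :
    dinv m t i = t i := if_pos h

/-- The inverse chart rescales the coordinates after the slot by `t_m/H`. -/
theorem dinv_apply_of_lt {t : Fin (k + 1) → ℝ} {i : Fin (k + 1)} (h : m < i) :
    dinv m t i = t i * t m / hiC m t := if_neg (not_le.2 h)

/-- The chart keeps the slot coordinate. -/
@[simp] theorem dch_self (t : Fin (k + 1) → ℝ) : dch m t m = t m := if_pos le_rfl

/-- The inverse chart keeps the slot coordinate. -/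
@[simp] theorem dinv_self (t : Fin (k + 1) → ℝ) : dinv m t m = t m := if_pos le_rfl

/-- The index `m - 1` is `≤ m`. -/
theorem pred_le (h : 0 < (m : ℕ)) : (⟨(m : ℕ) - 1, by omega⟩ : Fin (k + 1)) ≤ m :=
  Fin.le_def.2 (Nat.sub_le _ _)

/-- The chart fixes the upper neighbour. -/
@[simp] theorem hiC_dch (t : Fin (k + 1) → ℝ) : hiC m (dch m t) = hiC m t := by
  rw [hiC_eq, hiC_eq]
  split_ifs with h
  · exact dch_apply_of_le m (pred_le m h)
  · rfl

/-- The inverse chart fixes the upper neighbour. -/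
@[simp] theorem hiC_dinv (t : Fin (k + 1) → ℝ) : hiC m (dinv m t) = hiC m t := by
  rw [hiC_eq, hiC_eq]
  split_ifs with h
  · exact dinv_apply_of_le m (pred_le m h)
  · rfl

/-- `dinv ∘ dch = id` off `t_m = 0`, `H = 0`. -/
theorem dinv_dch {t : Fin (k + 1) → ℝ} (ht : t m ≠ 0) (hH : hiC m t ≠ 0) : dinv m (dch m t) = t := by
  ext i
  by_cases hi : i ≤ m
  · rw [dinv_apply_of_le m hi, dch_apply_of_le m hi]
  · rw [dinv_apply_of_lt m (not_le.1 hi), dch_apply_of_lt m (not_le.1 hi), dch_self, hiC_dch]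
    field_simp

/-- `dch ∘ dinv = id` off `t_m = 0`, `H = 0`. -/
theorem dch_dinv {t : Fin (k + 1) → ℝ} (ht : t m ≠ 0) (hH : hiC m t ≠ 0) : dch m (dinv m t) = t := by
  ext i
  by_cases hi : i ≤ m
  · rw [dch_apply_of_le m hi, dinv_apply_of_le m hi]
  · rw [dch_apply_of_lt m (not_le.1 hi), dinv_apply_of_lt m (not_le.1 hi), dinv_self, hiC_dinv]
    field_simp

/-- The chart is injective wherever `t_m ≠ 0 ≠ H`. -/
theorem injOn_dch {S : Set (Fin (k + 1) → ℝ)} (hS : ∀ t ∈ S, t m ≠ 0 ∧ hiC m t ≠ 0) :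
    InjOn (dch m) S := by
  intro t ht t' ht' h
  rw [← dinv_dch m (hS t ht).1 (hS t ht).2, h, dinv_dch m (hS t' ht').1 (hS t' ht').2]

/-! ### Semialgebraicity -/

/-- The chart is a `ℚ`-semialgebraic map on every `ℚ`-semialgebraic set.
[cite: BochnakCosteRoy1998, Prop. 2.2.6] -/
theorem isSemialgebraicMapOn_dch {S : Set (Fin (k + 1) → ℝ)} (hS : IsSemialgebraic ℚ S) :
    IsSemialgebraicMapOn ℚ S (dch m) := by
  refine IsSemialgebraicMapOn.of_forall hS fun i => ?_
  by_cases hi : i ≤ m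
  · exact (isSemialgebraicFunOn_apply hS i).congr fun t _ => (dch_apply_of_le m hi).symm
  · exact (((isSemialgebraicFunOn_apply hS i).fun_mul (isSemialgebraicFunOn_hiC hS m)).fun_mul
      (isSemialgebraicFunOn_apply hS m).fun_inv).congr fun t _ => by
        rw [dch_apply_of_lt m (not_le.1 hi), div_eq_mul_inv]

/-- The coordinates of the inverse chart are `ℚ`-semialgebraic on every `ℚ`-semialgebraic set.
[cite: BochnakCosteRoy1998, Prop. 2.2.6] -/
theorem isSemialgebraicFunOn_dinv_apply {S : Set (Fin (k + 1) → ℝ)} (hS : IsSemialgebraic ℚ S)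
    (i : Fin (k + 1)) : IsSemialgebraicFunOn ℚ S (fun t => dinv m t i) := by
  by_cases hi : i ≤ m
  · exact (isSemialgebraicFunOn_apply hS i).congr fun t _ => (dinv_apply_of_le m hi).symm
  · exact (((isSemialgebraicFunOn_apply hS i).fun_mul (isSemialgebraicFunOn_apply hS m)).fun_mul
      (isSemialgebraicFunOn_hiC hS m).fun_inv).congr fun t _ => by
        rw [dinv_apply_of_lt m (not_le.1 hi), div_eq_mul_inv]

/-- The inverse chart is a `ℚ`-semialgebraic map on every `ℚ`-semialgebraic set.
[cite: BochnakCosteRoy1998, Prop. 2.2.6] -/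
theorem isSemialgebraicMapOn_dinv {S : Set (Fin (k + 1) → ℝ)} (hS : IsSemialgebraic ℚ S) :
    IsSemialgebraicMapOn ℚ S (dinv m) :=
  IsSemialgebraicMapOn.of_forall hS (isSemialgebraicFunOn_dinv_apply m hS)

/-! ### The derivative of the chart and its Jacobian -/

/-- Row `i > m` of the derivative of the chart (Leibniz rule for `tᵢ · H · t_m⁻¹`). -/
def dchRow (t : Fin (k + 1) → ℝ) (i : Fin (k + 1)) : (Fin (k + 1) → ℝ) →L[ℝ] ℝ :=
  (t i * hiC m t) • ((-(t m ^ 2)⁻¹) •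
      ContinuousLinearMap.proj (R := ℝ) (φ := fun _ : Fin (k + 1) => ℝ) m) +
    (t m)⁻¹ • (t i • hiCD m + hiC m t •
      ContinuousLinearMap.proj (R := ℝ) (φ := fun _ : Fin (k + 1) => ℝ) i)

/-- `dchRow` evaluated on a vector. -/
theorem dchRow_apply (t : Fin (k + 1) → ℝ) (i : Fin (k + 1)) (v : Fin (k + 1) → ℝ) :
    dchRow m t i v = (t i * hiC m t) * (-(t m ^ 2)⁻¹ * v m) +
      (t m)⁻¹ * (t i * hiCD m v + hiC m t * v i) := by
  simp [dchRow, smul_eq_mul, mul_add]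

/-- The derivative of the chart at `t`. -/
def dchD (t : Fin (k + 1) → ℝ) : (Fin (k + 1) → ℝ) →L[ℝ] (Fin (k + 1) → ℝ) :=
  ContinuousLinearMap.pi fun i =>
    if i ≤ m then ContinuousLinearMap.proj (R := ℝ) (φ := fun _ : Fin (k + 1) => ℝ) i
    else dchRow m t i

/-- Components of `dchD`. -/
theorem dchD_apply (t v : Fin (k + 1) → ℝ) (i : Fin (k + 1)) :
    dchD m t v i = if i ≤ m then v i else dchRow m t i v := by
  unfold dchD
  rw [ContinuousLinearMap.pi_apply]
  split_ifs <;> rfl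

/-- **Differentiability of the chart** off `t_m = 0`. [folklore] -/
theorem hasFDerivAt_dch {t : Fin (k + 1) → ℝ} (ht : t m ≠ 0) : HasFDerivAt (dch m) (dchD m t) t := by
  refine hasFDerivAt_pi'.2 fun i => ?_
  by_cases hi : i ≤ m
  · have hfun : (fun x => dch m x i) = fun x => x i := funext fun x => dch_apply_of_le m hi
    have hD : (ContinuousLinearMap.proj i).comp (dchD m t) =
        ContinuousLinearMap.proj (R := ℝ) (φ := fun _ : Fin (k + 1) => ℝ) i := by
      ext v
      rw [ContinuousLinearMap.comp_apply, ContinuousLinearMap.proj_apply, dchD_apply, if_pos hi]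
      rfl
    rw [hfun, hD]
    exact hasFDerivAt_apply i t
  · have hfun : (fun x => dch m x i) = fun x => x i * hiC m x * (x m)⁻¹ :=
      funext fun x => by rw [dch_apply_of_lt m (not_le.1 hi), div_eq_mul_inv]
    have hD : (ContinuousLinearMap.proj i).comp (dchD m t) = dchRow m t i := by
      ext v
      rw [ContinuousLinearMap.comp_apply, ContinuousLinearMap.proj_apply, dchD_apply, if_neg hi]
    rw [hfun, hD]
    have h1 := hasFDerivAt_apply (𝕜 := ℝ) i t
    have h2 := hasFDerivAt_hiC m t
    have h3 : HasFDerivAt (fun x : Fin (k + 1) → ℝ => (x m)⁻¹)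
        ((-(t m ^ 2)⁻¹) • ContinuousLinearMap.proj (R := ℝ) (φ := fun _ : Fin (k + 1) => ℝ) m) t :=
      (hasDerivAt_inv ht).comp_hasFDerivAt t (hasFDerivAt_apply m t)
    exact (h1.fun_mul h2).fun_mul h3

/-- The diagonal entries of the matrix of `dchD`. -/
theorem dchD_single_self (t : Fin (k + 1) → ℝ) (a : Fin (k + 1)) :
    dchD m t (Pi.single a 1) a = if a ≤ m then 1 else hiC m t / t m := by
  rw [dchD_apply]
  split_ifs with ha
  · simp
  · have hma : m ≠ a := fun h => ha (h ▸ le_rfl)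
    have hD : hiCD m (Pi.single a (1:ℝ)) = 0 := by
      rw [hiCD_apply]
      split_ifs with hm
      · rw [Pi.single_apply, if_neg]
        intro he
        apply ha
        rw [← he]
        exact pred_le m hm
      · rfl
    rw [dchRow_apply, hD, Pi.single_apply, if_neg hma, Pi.single_apply, if_pos rfl]
    have ht : t m ≠ 0 ∨ t m = 0 := ne_or_eq _ _
    rcases ht with ht | ht
    · field_simp
      ring
    · simp [ht]

/-- The matrix of `dchD` vanishes above the diagonal. -/
theorem dchD_single_of_lt (t : Fin (k + 1) → ℝ) {a b : Fin (k + 1)} (hab : a < b) :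
    dchD m t (Pi.single b 1) a = 0 := by
  rw [dchD_apply]
  split_ifs with ha
  · simp [hab.ne]
  · have hmb : b ≠ m := fun h => ha (h ▸ hab).le
    have hD : hiCD m (Pi.single b (1:ℝ)) = 0 := by
      rw [hiCD_apply]
      split_ifs with hm
      · rw [Pi.single_apply, if_neg]
        intro he
        apply ha
        exact (hab.trans_le (he ▸ pred_le m hm)).le
      · rfl
    rw [dchRow_apply, hD, Pi.single_apply, if_neg hmb.symm, Pi.single_apply, if_neg hab.ne]
    ring

/-- `∏_{a} (if a ≤ m then 1 else c) = c^{k-m}` over `Fin (k+1)`. [folklore] -/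
theorem prod_ite_le_eq_pow (c : ℝ) :
    ∏ a : Fin (k + 1), (if a ≤ m then (1:ℝ) else c) = c ^ (k - (m : ℕ)) := by
  rw [Finset.prod_ite, Finset.prod_const_one, one_mul, Finset.prod_const]
  congr 1
  have : Finset.univ.filter (fun a : Fin (k + 1) => ¬ (a ≤ m)) = Finset.Ioi m := by
    ext a
    simp
  rw [this, Fin.card_Ioi]
  omega

/-- **The Jacobian of the chart**: `det (dchD m t) = (H / t_m)^{k-m}` (the matrix is lower
triangular with diagonal `1` (`i ≤ m`) and `H/t_m` (`i > m`)). [folklore] -/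
theorem det_dchD (t : Fin (k + 1) → ℝ) : (dchD m t).det = (hiC m t / t m) ^ (k - (m : ℕ)) := by
  classical
  have hentry : ∀ a b, LinearMap.toMatrix'
      (dchD m t : (Fin (k + 1) → ℝ) →ₗ[ℝ] (Fin (k + 1) → ℝ)) a b = dchD m t (Pi.single b 1) a :=
    fun a b => LinearMap.toMatrix'_apply _ a b
  have hdet : (dchD m t).det =
      (LinearMap.toMatrix' (dchD m t : (Fin (k + 1) → ℝ) →ₗ[ℝ] (Fin (k + 1) → ℝ))).det := by
    rw [ContinuousLinearMap.det, LinearMap.det_toMatrix']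
  rw [hdet, Matrix.det_of_lowerTriangular _ ?_]
  · rw [← prod_ite_le_eq_pow m (hiC m t / t m)]
    refine Finset.prod_congr rfl fun a _ => ?_
    rw [hentry]
    exact dchD_single_self m t a
  · intro a b hab
    rw [hentry]
    exact dchD_single_of_lt m t (OrderDual.toDual_lt_toDual.1 hab)

/-- `|det (dchD m t)| = (H/t_m)^{k-m}` when `t_m, H > 0`. [folklore] -/
theorem abs_det_dchD {t : Fin (k + 1) → ℝ} (ht : 0 < t m) (hH : 0 < hiC m t) :
    |(dchD m t).det| = (hiC m t / t m) ^ (k - (m : ℕ)) := by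
  rw [det_dchD, abs_of_pos (pow_pos (div_pos hH ht) _)]

end Dilation

/-- **Registered sub-goal `stub_dilationNLAux2`** of `stub_dilationNL` (the Jacobian bookkeeping
`Dilation.prod_ite_le_eq_pow`: the diagonal of the lower-triangular derivative of the dilation chart).
[folklore] -/
theorem stub_dilationNLAux2 : ∀ (k : ℕ) (m : Fin (k + 1)) (c : ℝ), (∏ a : Fin (k + 1), if a ≤ m then (1:ℝ) else c) = c ^ (k - (m : ℕ)) :=
  fun _ m c => Dilation.prod_ite_le_eq_pow m c

end Summit.KontsevichZagierPeriods.DihedralNormalForm.TorusDescent
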